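import Summits.BirchSwinnertonDyer.Rank1Residual.Additive.X4ThreeKuriharaCertKernel
import Summits.BirchSwinnertonDyer.Rank1Residual.Additive.KimDefectParityCertificates
import HarnessLib

/-!
# N11 LOWER@3 Kurihara-certificate KERNEL TOOL, sequel: the NEGATIVE record shape — a UNIT Kurihara
# number at a cyclic `𝒩₁` level on a Tamagawa-DEFECT row (`3 ∣ ∏ c_ℓ`) REFUTES `BSD(E,3)` granted the
# announced [K25] record (the K-TAM anomaly of PREDICTIONS-E2-AT3 as a kernel statement)
# (cell `b2b-bsdres`, team n1011, seat p03, OWNERS row T-a2-REC; over additive-p4's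
# `not_bsdp_of_kuriharaIndexLeAt_zero_of_tamagawa_pos_of_kim2025_OPEN`, file `KimDefectParityCertificates`)

HONEST FRAMING (cell `b2b-bsdres`, run/shared/lean/b2b/bsd-rank1-residual/, verbatim in every
file): the goal of the cell is to DELETE the COMBINATION-SHAPED residual classes of the
Birch–Swinnerton-Dyer formula for ALL analytic-rank `≤ 1` elliptic curves over `ℚ` — "full BSD
formula for every rank `≤ 1` curve in class `C`" assembled STRICTLY from published theorems — so
that the rank-`≤ 1` remainder becomes exactly the CONSTRUCTION-SHAPED classes, which are TYPED
(missing-input `Prop`s), NOT attempted. This is not "finishing BSD". Team n1011 is a RESEARCH ROUTE;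
no claim beyond the stated classes; the label X4 and the mark of RESIDUAL-MAP §I N11 (LOWER@3) are
UNCHANGED; nothing is booked. Theorems only (no definition, no named fact, no new `Prop`). EVERY
theorem is CONDITIONAL on the ANNOUNCED C.-H. Kim (app. R. Pollack), arXiv:2505.09121v1 (2025,
PREPRINT) Thm. 1.1 — binder `hK25s`, FLAG `Kim2025-preprint` — and reads, honestly: "EITHER BSD₃(E)
fails OR the announced statement as typed fails for E OR one of GZK / modularity fails" — it is an
ANOMALY DETECTOR for the E2-AT3 register (PREDICTIONS-E2-AT3 K-TAM line; r1's P-TAM3, §18.6), not a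
claim that BSD is false anywhere.

## What this file proves

Kim's refined conjecture (Conj. 1.10) predicts `∂^{(∞)}(δ̃) = ord_p ∏ c_ℓ` on a rank-`0` tower row; granted
[K25] Thm. 1.1, `BSD(E,p) ⟺ ∂^{(∞)} = ord_p ∏ c_ℓ` (additive-p4), so a UNIT Kurihara number at a cyclic
`𝒩₁` level (`∂^{(∞)} = 0`) on a row with `p ∣ ∏ c_ℓ` CONTRADICTS `BSD(E,p)`
(`not_bsdp_of_kuriharaIndexLeAt_zero_of_tamagawa_pos_of_kim2025_OPEN`, parity-free, `p ≥ 3`).  In the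
record vocabulary of `X4ThreeKuriharaCertKernel.lean`:

* `X4RankZero.not_bsdp_three_of_optimal_of_towerSurj_of_kuriharaUnitLevel_of_tamagawa_pos` — tower
  row, `r_an = 0`, OPTIMAL datum at `N ≤ 130000` (period transfer by `X4.periodTransfer_of_optimal`,
  `3 ∤ c_D` by Agashe–Ribet–Stein), `1 ≤ ord₃ ∏ c_ℓ`, and ONE unit Kurihara number of `D.f` at a cyclic
  `n ∈ 𝒩₁(E,3)` (level + cyclicity kernel-side as in the positive records, VALUE = EVIDENCE binder)
  ⟹ `¬ BSDp W 3`;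
* `X4RankZero.not_bsdp_three_of_intModel_of_optimal_of_kuriharaUnitLevel_of_tamagawa_pos` — the same
  with the tower read off an integer model by the caller (shape parallel to the positive unit-row record).

So, for the STAGE-2 register: a TWO-ENGINE level-1 unit on a DEF row (`3 ∣ ∏ c_ℓ`; e.g. the K-TAM /
T-DEF cells 13221g1, 17127b1, 11286q1, 15930u1, 19656b1) would instantiate these theorems into a
kernel statement `hK25s → hGZK → hmod → h26 → ¬ BSD₃(E)` — the formal form of the anomaly sentence.
Nothing is booked; no mark moves.

References: [Kim2025RefinedTNC] Thm. 1.1, Conj./App. §8.1.2 (PREPRINT); [Kim2022StructureSelmer] Conj. 1.10,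
§1.5.1; [AgasheRibetStein2006] Thm. 2.6; additive-p4's `Additive/KimDefectParityCertificates.lean`
(p258048) and `X4SharpThreeKimDefectParity.lean`; cell files cells/n1011/PREDICTIONS-E2-AT3.md (K-TAM,
A11/A12), cells/n1011/ROUTE-1.md §18.6 (P-TAM3), skel/T-a2-REC.md.
-/

noncomputable section

open scoped Classical MatrixGroups ModularForm

open CongruenceSubgroup WeierstrassCurve Literature.NumberTheory.EllipticCurves
  Literature.NumberTheory.EllipticCurves.ModularForms
  Literature.NumberTheory.EllipticCurves.Rank1Residual
  Literature.NumberTheory.EllipticCurves.Rank1Residual.Typed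
  Literature.NumberTheory.EllipticCurves.AgasheRibetStein2006
  Summit.BirchSwinnertonDyer.BirchSwinnertonDyer.Rank1Residual.IntModel
  Summit.BirchSwinnertonDyer.Rank1Residual.GaloisImage

namespace Summit.BirchSwinnertonDyer.Rank1Residual.Additive

open Summit.BirchSwinnertonDyer.Rank1Residual.X4

section Anomaly

variable (W : WeierstrassCurve ℚ) [W.IsElliptic] [W.IsGloballyMinimal]

/-- **T-a2-REC NEGATIVE record shape (K-TAM anomaly).** Tower row (`ρ̄_{E,3^n}` onto ∀ `n`), `r_an = 0`,
an OPTIMAL datum `D` at level `N ≤ 130000`, `1 ≤ ord₃ ∏ c_ℓ` (Tamagawa-DEFECT row), and ONE UNIT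
Kurihara number of `D.f` at a cyclic level `n ∈ 𝒩₁(E,3)` (`hn`, `hcyc` kernel-side once `n` is named;
`hδ` the EVIDENCE value) ⟹ `¬ BSD(E,3)` — GRANTED the announced [K25] Thm. 1.1 (`hK25s`), GZK and
modularity: i.e. such a datum refutes the conjunction, never BSD alone. Parity-free; additive-p4's
`not_bsdp_of_kuriharaIndexLeAt_zero_of_tamagawa_pos_of_kim2025_OPEN` with the level packaged by
`kuriharaIndexLeAt_of_level` and the period transfer from optimality. FLAG `Kim2025-preprint`.
[claim: Kim2025RefinedTNC, status: under-review]
[cite: Kim2025RefinedTNC, Thm. 1.1 ("BSD"), App. §8.1.2 (ANNOUNCED preprint — the reason, not a source of truth)]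
[cite: Kim2022StructureSelmer, Conj. 1.10 and §1.5.1 (PDF pp. 7–8)] [cite: AgasheRibetStein2006, Thm. 2.6 (p. 619)] -/
theorem X4RankZero.not_bsdp_three_of_optimal_of_towerSurj_of_kuriharaUnitLevel_of_tamagawa_pos
    (hK25s : Kim2025.thm11_kimShaLength_of_integralPeriod_OPEN)
    (hGZK : rank_eq_analyticRank_of_analyticRank_le_one) (hmod : hasEntireLFunction_rat)
    (h26 : cremona_abs_maninConstant_eq_one_of_level_le)
    (htower : ∀ n : ℕ, W.HasSurjectiveModNGaloisRep (3 ^ n : ℕ)) (hr : W.analyticRank = 0)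
    {N : ℕ} [NeZero N] (hN : N ≤ 130000) (D : ModularParametrizationData W N)
    (hopt : ∀ z ∈ D.L.lattice, ∃ w ∈ periodLattice D.f, z = D.c * w)
    (hc1 : 1 ≤ padicValNat 3 W.tamagawaProduct)
    (n : ℕ) [NeZero n] (hn : haveI : Fact (Nat.Prime 3) := ⟨Nat.prime_three⟩; Kato.IsKolyvaginProduct W 3 1 n)
    (hcyc : ∀ (ℓ : ℕ) [Fact ℓ.Prime], ℓ ∣ n →
      Nat.card {P : ((WeierstrassCurve.integralModelInt W).map
          (Int.castRingHom (ZMod ℓ))).toAffine.Point // 3 • P = 0} ≤ 3)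
    (hδ : ∃ ψ : (ℓ : ℕ) → (ZMod ℓ)ˣ →* Multiplicative (ZMod (3 ^ 1)),
      (∀ ℓ ∈ n.primeFactors, Function.Surjective (ψ ℓ)) ∧ kuriharaNumber D.f (3 ^ 1) n ψ ≠ 0) :
    haveI : Fact (Nat.Prime 3) := ⟨Nat.prime_three⟩
    ¬ BSDp W 3 := by
  haveI : Fact (Nat.Prime 3) := ⟨Nat.prime_three⟩
  have hc : ¬ (3 : ℤ) ∣ D.maninConstant := not_dvd_maninConstant_of_level_le h26 W D hopt hN Nat.prime_three
  have hper : ∃ u : ℚ, ‖(u : ℚ_[3])‖ = 1 ∧ W.realPeriodRat = u * plusPeriod D.f :=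
    periodTransfer_of_optimal 3 D hopt hc
  exact not_bsdp_of_kuriharaIndexLeAt_zero_of_tamagawa_pos_of_kim2025_OPEN W 3 hK25s hGZK hmod le_rfl hr
    htower D hper hc1 (kuriharaIndexLeAt_of_level 3 D.f 0 1 n le_rfl le_rfl hn hcyc hδ)

/-- **T-a2-REC NEGATIVE record shape, integer-model form** (the tower supplied by the caller from a
Frobenius certificate on the model, as in the positive records): `integralModelInt W = E₀`, `r_an = 0`,
OPTIMAL datum at `N ≤ 130000`, `1 ≤ ord₃ ∏ c_ℓ`, ONE unit Kurihara number at a cyclic `n ∈ 𝒩₁(E,3)` ⟹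
`¬ BSD(E,3)` granted `hK25s`, GZK, modularity. FLAG `Kim2025-preprint`.
[claim: Kim2025RefinedTNC, status: under-review]
[cite: Kim2025RefinedTNC, Thm. 1.1 ("BSD"), App. §8.1.2 (ANNOUNCED preprint — the reason, not a source of truth)]
[cite: Kim2022StructureSelmer, Conj. 1.10 and §1.5.1 (PDF pp. 7–8)] [cite: AgasheRibetStein2006, Thm. 2.6 (p. 619)] -/
theorem X4RankZero.not_bsdp_three_of_intModel_of_optimal_of_kuriharaUnitLevel_of_tamagawa_pos
    (hK25s : Kim2025.thm11_kimShaLength_of_integralPeriod_OPEN)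
    (hGZK : rank_eq_analyticRank_of_analyticRank_le_one) (hmod : hasEntireLFunction_rat)
    (h26 : cremona_abs_maninConstant_eq_one_of_level_le)
    {E₀ : WeierstrassCurve ℤ} (hI : integralModelInt W = E₀)
    (htower : ∀ n : ℕ, W.HasSurjectiveModNGaloisRep (3 ^ n : ℕ)) (hr : W.analyticRank = 0)
    {N : ℕ} [NeZero N] (hN : N ≤ 130000) (D : ModularParametrizationData W N)
    (hopt : ∀ z ∈ D.L.lattice, ∃ w ∈ periodLattice D.f, z = D.c * w)
    (hc1 : 1 ≤ padicValNat 3 W.tamagawaProduct)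
    (n : ℕ) [NeZero n] (hn : haveI : Fact (Nat.Prime 3) := ⟨Nat.prime_three⟩; Kato.IsKolyvaginProduct W 3 1 n)
    (hcyc : ∀ (ℓ : ℕ) [Fact ℓ.Prime], ℓ ∣ n →
      Nat.card {P : (E₀.map (Int.castRingHom (ZMod ℓ))).toAffine.Point // 3 • P = 0} ≤ 3)
    (hδ : ∃ ψ : (ℓ : ℕ) → (ZMod ℓ)ˣ →* Multiplicative (ZMod (3 ^ 1)),
      (∀ ℓ ∈ n.primeFactors, Function.Surjective (ψ ℓ)) ∧ kuriharaNumber D.f (3 ^ 1) n ψ ≠ 0) :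
    haveI : Fact (Nat.Prime 3) := ⟨Nat.prime_three⟩
    ¬ BSDp W 3 := by
  subst hI
  exact X4RankZero.not_bsdp_three_of_optimal_of_towerSurj_of_kuriharaUnitLevel_of_tamagawa_pos W hK25s
    hGZK hmod h26 htower hr hN D hopt hc1 n hn hcyc hδ

end Anomaly

end Summit.BirchSwinnertonDyer.Rank1Residual.Additive

end
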